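import Mathlib
import Summits.Schanuel.Schanuel.Theses.LogPatterns
import Summits.Schanuel.Schanuel.Theses.MatrixCoefficients

/-!
# Line `grading-split` for the crux `LogSector` (item stmt-Schanuel-4310, route MatrixCoefficients)

Seat `planner-cstrat-stmt-Schanuel-4310-r1-0` (crux-strategist, BC2 redirect). `LogSector` = algebraic
independence of `ℚ`-linearly independent logarithms of algebraic numbers, concluded BY NAME as
`Summit.Schanuel.Schanuel.Theses.LogPatterns.LogSector` (the primary decl of the shared item 4310; the
route-MatrixCoefficients copy `MatrixCoefficients.LogSector` has the identical body and is concluded as well,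
`LogSector_of_matrixCoefficients`).

THE LINE is the strategist's GRADING SPLIT `LogSector ⟸ HomLogSector ∧ LogHomogeneity` (glue proved in
`Cruxes/LogSector/Split.lean`, re-proved inline in `LogSector_of` below so that this file is self-contained),
with the homogeneous leaf entered through Roy's STRUCTURAL-RANK TRANSFER (Roy 1989 = Waldschmidt GL326 §1.4
p. 18: the homogeneous conjecture ⟺ rank = structural rank on `Mat(𝓛)`, i.e. Dasgupta–Kakde 2024 Conj. 1.1):

* `stub_homDetRep` — HOMOGENEOUS DETERMINANTAL REPRESENTATION (Valiant 1979 universality of the determinant,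
  homogenised; Dasgupta 2023 Lemma 4.13 and the proof of Thm 4.11): for `P ∈ ℚ[X₁..Xₙ]` homogeneous of degree
  `d` there are a size `m ≥ d` and rational matrices `B₀, …, Bₙ` with `det(x₀B₀ + Σ xᵢBᵢ) = x₀^{m−d}·P(x)`
  identically on `ℂⁿ⁺¹`. Provable now, M.
* `stub_freshLog` — `𝓛` has infinite `ℚ`-dimension: outside the `ℚ`-span of any finite family there is a
  logarithm of an algebraic number (a suitable `log p`, `p` prime, by unique factorisation). Provable now, S.
* `stub_squarePencilRigidity` — LINEAR RANK RIGIDITY AT LOGARITHMIC POINTS (OPEN; = Dasgupta–Kakde Conj. 1.1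
  for square pencils of full structural rank; the homogeneous leaf in the format of the six exponentials /
  linear subgroup theorems, where the tree PROVES Roy's `s ≤ 2·rank`,
  `Literature.Barriers.Schanuel.roy1995_structuralRank_le_two_mul_rank_holds`): a pencil `Σ λₖBₖ` of rational
  square matrices that is singular at a point `λ ∈ 𝓛ⁿ` with `ℚ`-linearly independent coordinates is
  identically singular. Hard stub (contains four exponentials at `m = 2`).
* `stub_logHomogeneity` — LEAF 2 verbatim (OPEN): relations among logarithms of algebraic numbers hold
  homogeneous component by homogeneous component (Baker's inhomogeneity principle in all degrees; degree ≤ 1 is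
  Baker's theorem; TwistedConjugacy's `TwistImpliesLogHomogeneity` is `TwistedSymmetry →` this, a live line;
  own skeleton `Lines/loghom-scaling.lean`).
* `homLogSector_of` — real proof of LEAF 1 from stubs 1–3: a homogeneous relation `P(l) = 0` of degree `d`
  becomes, with a fresh logarithm `μ` in the `x₀`-slot, a singular LINEAR pencil at the `ℚ`-independent log
  point `(μ, l)` (value `μ^{m−d}·P(l) = 0`), hence an identically singular pencil (stub 3), hence
  `x₀^{m−d}·P ≡ 0` on `ℂⁿ⁺¹`, hence (at `x₀ = 1`) `P ≡ 0` on `ℂⁿ`, hence `P = 0`.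
* `LogSector_of` — the crux from the four stubs (kernel-checked, no sorry): the grading glue.

Costume check: no stub is the crux or the summit; stub 3 ⟺ LEAF 1 (not the crux) modulo stubs 1–2, stub 4 IS
LEAF 2 (not the crux); LEAF 1 ∧ LEAF 2 ⟺ crux is the filed decomposition (children.json), each leaf strictly
below the crux as far as known (Waldschmidt GL326 p. 18 keeps the homogeneous and the full conjecture apart).
Disproof used: none registered for stmt-Schanuel-4310 (no `Cruxes/LogSector/Disproof.lean`).
-/

noncomputable section

set_option linter.dupNamespace false

namespace Summit.Schanuel.Schanuel.Cruxes.LogSector.GradingSplitLine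

open Summit.Schanuel.Schanuel.Theses.LogPatterns (LogSector)

/-- STUB 1 (provable now, M): homogeneous determinantal representation over `ℚ` — every homogeneous
polynomial of degree `d` in `n` variables is, up to the factor `x₀^{m−d}`, the determinant of a square pencil
`x₀B₀ + Σᵢ xᵢ₊₁Bᵢ₊₁` of rational matrices (as functions on `ℂⁿ⁺¹`). [Valiant 1979 Thm 1 (universality of the
determinant), homogenised; Dasgupta2023 Lemma 4.13 and proof of Thm 4.11] -/
theorem stub_homDetRep :
    ∀ (n d : ℕ) (P : MvPolynomial (Fin n) ℚ), P.IsHomogeneous d →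
      ∃ (m : ℕ) (B : Fin (n + 1) → Matrix (Fin m) (Fin m) ℚ), d ≤ m ∧
        ∀ x : Fin (n + 1) → ℂ,
          (∑ k, x k • (B k).map (algebraMap ℚ ℂ)).det =
            x 0 ^ (m - d) * MvPolynomial.aeval (fun i : Fin n => x i.succ) P := by
  sorry

/-- STUB 2 (provable now, S): outside the `ℚ`-span of finitely many complex numbers there is a logarithm of
an algebraic number (`𝓛 ⊇ {log p : p prime}` has infinite `ℚ`-dimension by unique factorisation).
[folklore; BakerTNT1975 Ch. 2] -/
theorem stub_freshLog :
    ∀ (n : ℕ) (l : Fin n → ℂ), ∃ μ : ℂ, IsAlgebraic ℚ (Complex.exp μ) ∧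
      μ ∉ Submodule.span ℚ (Set.range l) := by
  sorry

/-- STUB 3 (OPEN, hard; TRANSFER of LEAF 1): linear rank rigidity of rational square pencils at points of
`𝓛ⁿ` with `ℚ`-linearly independent coordinates — singular at `λ` ⇒ identically singular. This is the
Structural Rank Conjecture on `Mat(𝓛)` [DasguptaKakde2024 Conj. 1.1] for square pencils of full structural
rank, equivalent to the homogeneous conjecture of algebraic independence of logarithms [Waldschmidt2000 §1.4
p. 18, after Roy 1989; Roy1995 §3.1 Cor. 3.2]; the tree proves the half `s ≤ 2·rank`
(`roy1995_structuralRank_le_two_mul_rank_holds`). -/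
theorem stub_squarePencilRigidity :
    ∀ (n m : ℕ) (B : Fin n → Matrix (Fin m) (Fin m) ℚ) (lam : Fin n → ℂ),
      (∀ i, IsAlgebraic ℚ (Complex.exp (lam i))) → LinearIndependent ℚ lam →
        (∑ k, lam k • (B k).map (algebraMap ℚ ℂ)).det = 0 →
          ∀ x : Fin n → ℂ, (∑ k, x k • (B k).map (algebraMap ℚ ℂ)).det = 0 := by
  sorry

/-- STUB 4 (OPEN; LEAF 2 of the split, verbatim): every rational polynomial relation among logarithms of
algebraic numbers holds homogeneous component by homogeneous component. [BakerTNT1975 Thm 2.1 (degree ≤ 1);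
Roy1995 §3.1 Remark p. 65; route TwistedConjugacy item `TwistImpliesLogHomogeneity`] -/
theorem stub_logHomogeneity :
    ∀ (r : ℕ) (l : Fin r → ℂ), (∀ j, IsAlgebraic ℚ (Complex.exp (l j))) →
      ∀ P : MvPolynomial (Fin r) ℚ, MvPolynomial.aeval l P = 0 →
        ∀ d : ℕ, MvPolynomial.aeval l (MvPolynomial.homogeneousComponent d P) = 0 := by
  sorry

/-! ### Stub statements by name -/

namespace Statement

/-- Statement of `stub_homDetRep`. -/
abbrev stub_homDetRep : Prop := type_of% @GradingSplitLine.stub_homDetRep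
/-- Statement of `stub_freshLog`. -/
abbrev stub_freshLog : Prop := type_of% @GradingSplitLine.stub_freshLog
/-- Statement of `stub_squarePencilRigidity`. -/
abbrev stub_squarePencilRigidity : Prop := type_of% @GradingSplitLine.stub_squarePencilRigidity
/-- Statement of `stub_logHomogeneity`. -/
abbrev stub_logHomogeneity : Prop := type_of% @GradingSplitLine.stub_logHomogeneity

end Statement

/-- LEAF 1 (`HomLogSector`, verbatim the child statement filed in children.json) from stubs 1–3 — real
proof: a homogeneous relation of degree `d` at `l` is a singular LINEAR pencil at the `ℚ`-independent log
point `(μ, l)` for a fresh logarithm `μ` (stubs 1, 2), hence an identically singular pencil (stub 3),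
hence `P ≡ 0` on `ℂⁿ` (slot `x₀ = 1`), hence `P = 0`. -/
theorem homLogSector_of (h₁ : Statement.stub_homDetRep) (h₂ : Statement.stub_freshLog)
    (h₃ : Statement.stub_squarePencilRigidity) :
    ∀ (n : ℕ) (l : Fin n → ℂ), (∀ i, IsAlgebraic ℚ (Complex.exp (l i))) → LinearIndependent ℚ l →
      ∀ (d : ℕ) (P : MvPolynomial (Fin n) ℚ), P.IsHomogeneous d → P ≠ 0 →
        MvPolynomial.aeval l P ≠ 0 := by
  intro n l halg hli d P hP hne hval
  obtain ⟨m, B, _hdm, hB⟩ := h₁ n d P hP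
  obtain ⟨μ, hμalg, hμspan⟩ := h₂ n l
  -- the extended log point (μ, l)
  set lam : Fin (n + 1) → ℂ := Fin.cons μ l with hlam
  have hlam_alg : ∀ i, IsAlgebraic ℚ (Complex.exp (lam i)) := by
    refine Fin.cases ?_ ?_
    · simpa [hlam] using hμalg
    · intro i; simpa [hlam] using halg i
  have hlam_li : LinearIndependent ℚ lam := by
    rw [hlam, linearIndependent_finCons]
    exact ⟨hli, hμspan⟩
  have hdet : (∑ k, lam k • (B k).map (algebraMap ℚ ℂ)).det = 0 := by
    rw [hB lam]
    have htail : (fun i : Fin n => lam i.succ) = l := by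
      funext i; simp [hlam]
    rw [htail, hval, mul_zero]
  have hall := h₃ (n + 1) m B lam hlam_alg hlam_li hdet
  -- P vanishes on ℂⁿ (slot x₀ = 1)
  have hP0 : ∀ y : Fin n → ℂ, MvPolynomial.aeval y P = 0 := fun y => by
    have h := hall (Fin.cons 1 y)
    rw [hB (Fin.cons 1 y)] at h
    simpa using h
  -- hence P = 0
  apply hne
  apply MvPolynomial.map_injective (algebraMap ℚ ℂ) (algebraMap ℚ ℂ).injective
  rw [map_zero]
  apply MvPolynomial.funext
  intro y
  rw [MvPolynomial.eval_map, ← MvPolynomial.aeval_def, hP0 y, map_zero]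

/-- COMPOSITION (kernel-checked, no sorry; stub statements BY NAME): the crux `LogSector` from the four
stubs — LEAF 1 from stubs 1–3 (`homLogSector_of`), LEAF 2 = stub 4, and the grading glue: a relation
`P(l) = 0` holds degree by degree (LEAF 2), each homogeneous component then vanishes as a polynomial
(LEAF 1), and `P = Σ_d P_d`. -/
theorem LogSector_of (h₁ : Statement.stub_homDetRep) (h₂ : Statement.stub_freshLog)
    (h₃ : Statement.stub_squarePencilRigidity) (h₄ : Statement.stub_logHomogeneity) : LogSector := by
  have hHom := homLogSector_of h₁ h₂ h₃
  intro n l halg hli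
  rw [algebraicIndependent_iff]
  intro P hP
  rw [← MvPolynomial.sum_homogeneousComponent P]
  refine Finset.sum_eq_zero fun d _ => ?_
  by_contra hne'
  exact hHom n l halg hli d _ (MvPolynomial.homogeneousComponent_isHomogeneous d P) hne'
    (h₄ n l halg P hP d)

/-- The crux along this line MODULO exactly the four registered stubs (depends on `sorryAx` only through
`stub_*`). -/
theorem LogSector_proof : LogSector :=
  LogSector_of stub_homDetRep stub_freshLog stub_squarePencilRigidity stub_logHomogeneity

/-- The same composition concluding the route-MatrixCoefficients copy of the shared crux (identical body). -/
theorem LogSector_of_matrixCoefficients (h₁ : Statement.stub_homDetRep) (h₂ : Statement.stub_freshLog)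
    (h₃ : Statement.stub_squarePencilRigidity) (h₄ : Statement.stub_logHomogeneity) :
    Summit.Schanuel.Schanuel.Theses.MatrixCoefficients.LogSector :=
  fun n l halg hli => LogSector_of h₁ h₂ h₃ h₄ n l halg hli

end Summit.Schanuel.Schanuel.Cruxes.LogSector.GradingSplitLine

end
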